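import Literature.NumberTheory.Automorphic.CDTTheorem722ThreeFactsProofs
import Literature.NumberTheory.EllipticCurves.IsogenyFrobeniusTraceHoldsProofs
import Literature.NumberTheory.EllipticCurves.EichlerShimuraCongruenceHondaProofs
import Literature.NumberTheory.EllipticCurves.CuspFormLFunctionLevelConductorProofs
import HarnessLib

/-!
# Stub ideation `stub_threeImpTwo` (S9) — ideator k = 1, generation 12 (FAMILY 1: recognise & import)

Companion of `STUB-IDEAS-stub_threeImpTwo-1.md` (gen 12).  Crux `FreyModularity` (stmt-ABC-11340),
skeleton `Lines/Sketch.lean` (sha 21576c53), stub `stub_threeImpTwo` :186 (verbatim type = `SigS9`).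

Gen 12 adds ONE kernel-checked FAMILY-1 fact to the gen-9/11 record (`…_1g9.lean`, H1–H9, re-checked
rc 0 today): the tree match run on the LEAVES.  Both leaves of Plan A — `eichlerShimuraConstruction`
and `∀ N, IsNewformOf.level_eq_conductorNorm` — and the stub itself are, IN THE TREE, corollaries of
the single catalogued named fact `exists_isNewformOf` (BCDT Theorem A), by PROVED theorems
(`eichlerShimuraConstruction_of_exists_isNewformOf`, EichlerShimuraCongruenceHondaProofs :538;
`IsNewformOf.level_eq_conductorNorm_of_exists_isNewformOf'`, CuspFormLFunctionLevelConductorProofs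
:295; `BCDT.exists_isNewformOf_iff`, BCDTModularity).  Consequence for the plan: the tree has NO
producer of any S9 leaf other than Theorem A, of which the crux `FreyModularity` is the Frey special
case — so a prover's `blocked-on` must name the leaves with INDEPENDENT printed proofs (Shimura 1971 /
Knapp 11.74; Carayol 1986; Saito 1988 at `2`), never `exists_isNewformOf`.
-/

noncomputable section

open scoped NumberField MatrixGroups ModularForm
open NumberField IsDedekindDomain CongruenceSubgroup
open Literature.NumberTheory.EllipticCurves
open Literature.NumberTheory.EllipticCurves.ModularForms
open Literature.NumberTheory.Automorphic
open Literature.NumberTheory.Automorphic.BCDT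
open Literature.NumberTheory.GaloisRepresentations
open WeierstrassCurve

namespace Summit.ABC.ABC.Cruxes.FreyModularity.Sketch.StubIdeasThreeImpTwo1G12

/-- The registered stub's type, character for character (`Lines/Sketch.lean` :186). -/
def SigS9 : Prop :=
  ∀ (W : WeierstrassCurve ℚ) [W.IsElliptic] [NeZero (W.conductorNorm ℤ)] (ℓ : ℕ) [Fact ℓ.Prime],
    W.IsModularGaloisRepTate ℓ → BCDT.IsModular W

/-- `hC`, the second binder of the skeleton closer `stub_threeImpTwo_of_two_facts` (:584), verbatim. -/
def CarayolLevel : Prop :=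
  ∀ (N : ℕ) [NeZero N], IsNewformOf.level_eq_conductorNorm (N := N)

/-- **G12-1 (PROVED): both Plan-A leaves are in-tree corollaries of BCDT Theorem A.** -/
theorem leaves_of_thmA (hA : exists_isNewformOf) : eichlerShimuraConstruction ∧ CarayolLevel :=
  ⟨eichlerShimuraConstruction_of_exists_isNewformOf hA,
    fun _ _ ↦ IsNewformOf.level_eq_conductorNorm_of_exists_isNewformOf' hA⟩

/-- **G12-2 (PROVED): the stub from Theorem A through the leaves** (Plan A's closer fed by G12-1). -/
theorem sigS9_of_thmA_via_leaves (hA : exists_isNewformOf) : SigS9 :=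
  fun W _ _ ℓ _ h ↦
    isModular_of_isModularGaloisRepTate_of_three_facts (leaves_of_thmA hA).1
      isIsogenous_iff_frobeniusTrace_eq_holds (fun N _ ↦ (leaves_of_thmA hA).2 N) W ℓ h

/-- **G12-3 (PROVED): the stub from Theorem A, trivially** (the hypothesis is not used) — the
anti-costume witness: any in-tree discharge of S9's leaves today factors through the summit of the
crux. -/
theorem sigS9_of_thmA_trivial (hA : exists_isNewformOf) : SigS9 :=
  fun W _ _ _ _ _ ↦ exists_isNewformOf_iff.mp hA W

end Summit.ABC.ABC.Cruxes.FreyModularity.Sketch.StubIdeasThreeImpTwo1G12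

end
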